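import Summits.RiemannHypothesis.RiemannHypothesis.Theorems.GroundBartaEvenWinsBeyondArchDeflationM78FAssemblyE3
import Summits.RiemannHypothesis.RiemannHypothesis.Theorems.GroundBartaEvenWinsBeyondArchDeflationCertBridgeSigma
import Summits.RiemannHypothesis.RiemannHypothesis.Theorems.GroundBartaEvenWinsBeyondArchDeflationPSDFromBounds
import Summits.RiemannHypothesis.RiemannHypothesis.Theorems.WeilGroundStateGroundStateSimpleEvenTrialUpperFConst
import Summits.RiemannHypothesis.RiemannHypothesis.Theorems.WeilTwoPrimeDeflM78FCert
import Literature.NumberTheory.LFunctions.WeilDeflationPenaltyPolyEval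
import HarnessLib

/-!
# RiemannHypothesis / GroundBarta — rung 4 (`EvenWinsBeyondArch`, stmt-RiemannHypothesis-18807 / 18085):
# the deflated Temple L-side at `c = 39/50` — the final inequality `λ ≤ ε_od(39/50)` modulo the sigma data

Helper file (`--supports`), RH-free.  Prover A, speedrun unit `sr-gb-rung-a` (gen 2).  Generated by `cert/abgen/gen_final.py`.

`dt_m78F_oddLower_of_sigma`: from the deflated two-prime certificate M78F (`deflBound_weilCertDeflM78F`: `β₂₃ = 17/25`,
`a₀ = 39/50`, six odd dyadic penalties), the certified A-layer matrix (`m78F_A_mem`, `m78F_inner`, file …M78FAssembly), the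
`log 2` bracket `tuf_log_two_bounds`, and — as HYPOTHESES — prover B's residual norm bounds `s_i` (sigma criterion) with
weights `θ`, budget `τ`, and a kernel PSD certificate (`nCheck₂` + scaled LDL data) for `(β−λ)(A−λG) − τ diag θ`:
`λ ≤ ε_od(39/50)`.  The trial vectors of the bridge are `v_i = 𝟙·maskPoly(r_i)`; `m78F_mask` identifies them with
`m78Fv i = 𝟙·P_i(x/b)` (trimmed coefficient lists, `maskPoly_eq_poly_eval_of_trim`).
-/

set_option linter.dupNamespace false

noncomputable section

open MeasureTheory Set
open scoped BigOperators ComplexConjugate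

namespace Summit.RiemannHypothesis.RiemannHypothesis.Theorems.EvenWinsBeyondArch

open Literature.NumberTheory.LFunctions Literature.Analysis.ValidatedNumerics.ExpPoly
open Literature.Analysis.ValidatedNumerics.PolyMP Summit.RiemannHypothesis.RiemannHypothesis.Theorems.EvenWinsBeyondArch.ArchM78F
open Summit.RiemannHypothesis.RiemannHypothesis.Theorems.OddSector (weilDirichletEnergy₂ weilPoleForm₂)
open Summit.RiemannHypothesis.RiemannHypothesis.Theorems.GroundStateSimpleEven (tuf_log_two_bounds)

/-- The penalty list of certificate M78F has six entries. [folklore] -/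
theorem m78F_Rlen : weilCertDeflM78FR.length = 6 := rfl

set_option maxHeartbeats 0 in
/-- The certificate's masked coefficient vectors are the trimmed data polynomials `P_i` padded with zeros. [folklore] -/
theorem m78F_trim : ∀ i : Fin 6, (List.range 256).map (maskV (weilCertDeflM78FR.get (Fin.cast m78F_Rlen.symm i))) =
    m78FP i ++ List.replicate (256 - (m78FP i).length) 0 := by
  decide +kernel

/-- Odd parities and non-negative weights of the penalties. [folklore] -/
theorem m78F_Rodd : (∀ i : Fin weilCertDeflM78FR.length, (weilCertDeflM78FR.get i).2.1 % 2 = 1) ∧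
    (∀ i : Fin weilCertDeflM78FR.length, 0 ≤ (weilCertDeflM78FR.get i).1) := by
  constructor <;> decide

/-- **The bridge's trial vectors are the A-layer vectors**: `𝟙_{[-c,c]}·maskPoly(r_i, 256, 18/25) = m78Fv i`. [folklore] -/
theorem m78F_mask (i : Fin 6) (x : ℝ) :
    (((Icc (-(39 / 50 : ℝ)) (39 / 50)).indicator (fun x ↦ maskPoly (weilCertDeflM78FR.get (Fin.cast m78F_Rlen.symm i)) 256 (39 / 50) x) x
        : ℝ) : ℂ) = m78Fv i x := by
  unfold m78Fv
  rw [dt_wY_apply]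
  push_cast
  congr 1
  by_cases hx : x ∈ Icc (-(39 / 50 : ℝ)) (39 / 50)
  · rw [indicator_of_mem hx, indicator_of_mem (by simpa using hx), maskPoly_eq_poly_eval_of_trim _ _ (m78F_trim i)]
  · rw [indicator_of_notMem hx, indicator_of_notMem (by simpa using hx)]

/-- The window image of `v_i` at `c = 39/50` (the bridge's `F_i`, stated for `m78Fv`). [folklore] -/
def m78FF (i : Fin 6) (y : ℝ) : ℂ :=
  (Icc (-(39 / 50 : ℝ)) (39 / 50)).indicator (fun y ↦
      2 * (∫ x, m78Fv i x * (Real.cosh (x / 2) : ℂ)) * (Real.cosh (y / 2) : ℂ) -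
        2 * (∫ x, m78Fv i x * (Real.sinh (x / 2) : ℂ)) * (Real.sinh (y / 2) : ℂ) +
      (∑ m ∈ weilPrimeIndex (39 / 50 : ℝ), (((ArithmeticFunction.vonMangoldt m : ℝ) / Real.sqrt m : ℝ) : ℂ) *
        (2 * m78Fv i y - m78Fv i (y - Real.log m) - m78Fv i (y + Real.log m))) +
      ∫ t in Ioi 0, (weilArchDensity t : ℂ) * (2 * m78Fv i y - m78Fv i (y - t) - m78Fv i (y + t))) y -
    (weilMarkovConstant (39 / 50 : ℝ) : ℂ) * m78Fv i y

/-- The `β` bracket: `β = 17/25 − (log 2)/2`. [folklore] -/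
def m78Fβlo : ℚ := 16 / 25 - (346573590279972654708623 / 500000000000000000000000) / 2
/-- [folklore] -/
def m78Fβhi : ℚ := 16 / 25 - (346573590279972654708609 / 500000000000000000000000) / 2

/-- [folklore] -/
theorem m78F_beta_mem : ((m78Fβlo : ℚ) : ℝ) ≤ 16 / 25 - Real.log 2 / 2 ∧ 16 / 25 - Real.log 2 / 2 ≤ ((m78Fβhi : ℚ) : ℝ) := by
  obtain ⟨h1, h2⟩ := tuf_log_two_bounds
  unfold m78Fβlo m78Fβhi; push_cast; constructor <;> linarith

/-- **`λ ≤ ε_od(39/50)` modulo the sigma data.**  Prover B supplies `W`, `s`, `θ` (positive), the residual bounds `hs`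
for `m78Fv` / `m78FF`, the budget `Σ s_i/θ_i ≤ τ`; the kernel PSD certificate (`nCheck₂` + scaled LDL data) is generated by
`cert/abgen/psdcert.py`. [cite: GoerischHaunhorst1985, §2] -/
theorem dt_m78F_oddLower_of_sigma (W : Fin 6 → Fin 6 → ℝ) (s : Fin 6 → ℝ) (θq : Fin 6 → ℚ) (hθ : ∀ i, 0 < θq i)
    (hs : ∀ i, ∫ x, ‖(m78FF i - ∑ l, W i l • m78Fv l) x‖ ^ 2 ≤ s i) (τ : ℚ) (hτ : ∑ i, s i / (θq i : ℝ) ≤ (τ : ℝ))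
    (lam : ℚ) (hlam : lam < m78Fβlo) {m : ℕ} (sc : Fin 6 → ℚ) (P E : Fin 6 → Fin 6 → ℚ) (D : Fin m → ℚ)
    (L : Fin m → Fin 6 → ℚ) (δ : ℚ) (hchk : nCheck₂ m78Fβlo m78Fβhi lam τ θq sc m78FAlo m78FAhi m78FG P E = true)
    (hrow : ∀ i, ∑ j, E i j ≤ δ) (hcol : ∀ j, ∑ i, E i j ≤ δ) (hD : ∀ r, 0 ≤ D r)
    (hP : ∀ i j, P i j = δ * (if i = j then 1 else 0) + ∑ r, D r * L r i * L r j) :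
    (lam : ℝ) ≤ weilOddGroundEnergy (39 / 50 : ℝ) := by
  have hc : (0 : ℝ) < 39 / 50 := by norm_num
  have hc5 : (39 / 50 : ℝ) ≤ Real.log 5 / 2 := by have := m78_le_log5; push_cast at this; linarith
  have hβ := m78F_beta_mem
  have hlamR : (lam : ℝ) < 16 / 25 - Real.log 2 / 2 := by
    have : ((lam : ℚ) : ℝ) < ((m78Fβlo : ℚ) : ℝ) := by exact_mod_cast hlam
    linarith [hβ.1]
  -- the certificate conclusion in the bridge's form
  have hcert := fun (g : ℝ → ℂ) (hg : IsWeilTest g) (hsupp : tsupport g ⊆ Icc (-(39 / 50 : ℝ)) (39 / 50))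
      (hodd : ∀ x, g (-x) = -g x) ↦ deflBound_weilCertDeflM78F hg hsupp hodd
  obtain ⟨hN1, ha0⟩ := params_weilCertDeflM78F
  have hβ23 : ((weilCertDeflM78FBeta : ℚ) : ℝ) = 16 / 25 := by show (((16 / 25 : ℚ)) : ℝ) = _; norm_num
  simp only [hN1, ha0, hβ23] at hcert
  -- the A-layer hN
  have hA := m78F_A_mem
  have hG := m78F_inner
  have hN := dt_hN_of_bounds₂
    (fun i j ↦ weilPoleForm₂ (m78Fv i) (m78Fv j) + weilDirichletEnergy₂ (((39 / 50 : ℚ)) : ℝ) (m78Fv i) (m78Fv j) -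
      weilMarkovConstant (((39 / 50 : ℚ)) : ℝ) * ∫ x, (m78Fv i x * conj (m78Fv j x)).re)
    m78FAlo m78FAhi m78FG hA (fun i j ↦ ∫ x, (m78Fv i x * conj (m78Fv j x)).re) hG m78Fβlo m78Fβhi hβ lam τ θq sc P E D L δ
    hchk hrow hcol hD hP
  have h1825 : (((39 / 50 : ℚ)) : ℝ) = (39 / 50 : ℝ) := by norm_num
  simp only [h1825] at hN
  exact dt_weilOddGroundEnergy_ge_of_deflCert_sigma hc hc5 le_rfl weilCertDeflM78FR 256 m78F_Rodd.1 m78F_Rodd.2 hcert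
    m78Fv m78FF (fun i x ↦ (m78F_mask i x).symm) (fun i y ↦ rfl) W hlamR s (fun i ↦ (θq i : ℝ))
    (fun i ↦ by exact_mod_cast hθ i) hs hτ hN

end Summit.RiemannHypothesis.RiemannHypothesis.Theorems.EvenWinsBeyondArch

end
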